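import Summits.BirchSwinnertonDyer.BirchSwinnertonDyer.Theorems.PrintCFramBottomClassIndexLawFiveLeHeegnerFieldSupplySeed
import Literature.NumberTheory.Congruences.BernoulliCharacterTeichmullerCongruenceRamified
import Summits.BirchSwinnertonDyer.BirchSwinnertonDyer.Theorems.PrintCFramBottomClassIndexLawFiveLeKrizLiBindersAnchorBase
import HarnessLib

/-!
# Crux `PrintCFram.BottomClassIndexLawFiveLe` (stmt-BirchSwinnertonDyer-20372), line `eisenstein-resource-bdp-line` (registry v19):
# THE CM REFLECTION OF THE CLASS FACTOR — `(1/k) B_{k, χ·(·/p)} ≡ (1/(p−k)) B_{p−k, χ} (mod p)` for `k ∈ {(p+1)/4, (3p−1)/4}`,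
# i.e. `H(k, p·N) ≡ H(p−k, N) (mod p)`: the class factor of Stub C is ONE coefficient of the field-factor series
# (cell `bsd-print-cfram`, width seat `bsd-line-cfram-p1-w8` g5; THEOREMS ONLY, `--supports` 20372; BSD is not proved by any of this)

HONEST FRAMING. Nothing here is a statement about BSD and no stub is closed. w8 g3/g4 put registry v19's Stub C
(`stub_heegnerField_of_unitClassFactor`) into the curve-free currency `(P)` of `…HeegnerFieldSupplySocket`: the CLASS factor is
`‖(p−k)⁻¹ B_{p−k,χ}‖_p` and the FIELD factor at a quadratic field `K` is `‖k⁻¹ B_{k,(χ·ε_K)~}‖_p`, `χ = χ_e` the member's quadratic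
character (conductor `m ⊥ p`), `k ∈ {(p+1)/4, (3p−1)/4}`. The companion file `…HeegnerFieldSupplySeed` (p680216) showed on the
crux's own binders that at the CM field `K₀ = ℚ(√−p)` the field factor IS the class factor (an identity of primitive characters).
This file proves the same statement in the `(P)` currency, where it is a genuine congruence between generalized Bernoulli numbers
of DIFFERENT index and DIFFERENT conductor:

  `‖(1/k) B_{k, χ↑·(ω^{(p−1)/2})↑} − (1/(p−k)) B_{p−k, χ}‖_p < 1`      (`norm_div_generalizedBernoulli_legendreTwist_sub_div_lt_one`)

for EVERY `ℚ_p`-valued character `χ` modulo `m ⊥ p`, `p ≡ 3 (mod 4)`, `p ≥ 7`, `ω` Teichmüller (so `ω^{(p−1)/2} = (·/p)`, the Kronecker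
character of `K₀`, `…Seed.teichmuller_pow_half_eq_legendreSym`). Both sides are `≡ B_{1, χ↑(ω^{p−1−k})↑}`: the right by the
tree's tame Kummer congruence (`CharacterTwist.norm_generalizedBernoulli_one_sub_div_lt_one`, w8 g3's engine), the left by its
RAMIFIED-branch twin landed for this purpose (`CharacterTwist.norm_generalizedBernoulli_one_sub_div_lt_one_ramified`, p680467) with
`a = (p−1)/2`, because `(p−1)/2 + k − 1 ≡ p−1−k (mod p−1)` exactly for these two `k` (`…Seed.half_add_classExponent_pred`).

READING (Cohen–Eisenstein numbers `H(r, N) = −B_{r,χ_D}/r · (divisor sum)`, `(−1)^r N = D f²`): since `χ_{−pD} = χ_D·(·/p)` for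
`p ≡ 3 (4)`, the congruence says `H(k, p·N) ≡ H(p−k, N) (mod p)` for every `N` prime to `p` (the divisor sums agree mod `p` as
`a^{k−1}(a/p) ≡ a^{p−1−k}` and `2k−1 ≡ 2(p−k)−1 (mod p−1)`), i.e. `H_k | U_p ≡ H_{p−k} (mod p)` coefficientwise — consistent with
Serre–Katz weights since `U_p` on half-integral weight carries the nebentypus `(·/p) = ω^{(p−1)/2}`, a weight shift of `(p−1)/2`.
So the class factor of the member with character `χ_e` — a unit by Stub C's hypothesis — is the coefficient of index `p·|e|` of the
weight-`k+1/2` Cohen–Eisenstein series whose coefficients at `|e·d|` are the field factors: the SEED from which a mod-`p`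
non-vanishing argument for `(P)` (Sturm / theta-operator dichotomy at `p`) must start, located at the one discriminant `d = −p` the
Heegner hypothesis excludes (`…Seed.not_satisfiesHeegnerHypothesis_cmField`). Verified in exact arithmetic before typing
(`work/num/reflect.py`: `p ∈ {7,11,19,23}`, all fundamental `|e| ≤ 40`, both `k`: 0 failures). beyond-print theorem: NO.

CONTENTS. §1 bookkeeping (the exponent identity as an identity of characters, `(p−1) ∤ (p−1)/2 + k`). §2 the
reflection congruence and its `‖·‖ ≤ p⁻¹` form. §3 on the crux's binders: B1's premise / Stub C's class hypothesis read on
`(1/k)B_{k,χ·(·/p)}`. §4 the character `χ↑(ω^{(p−1)/2})↑` IS `(χ·ε_{K₀})~`: primitive of conductor `m·p` with the values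
`χ(ℓ)ε_{K₀}(ℓ)` at every prime `ℓ ≠ p`.

References: [Washington1997] Thm. 5.11, Cor. 5.13, §5.1; [LangCyclotomic1990] Ch. 2 §2 Thm. 2.5; [KrizLi2019] Thm. 1.20, §8;
[Cohen1975] (`H(r,N)`); registry v19 `Cruxes/BottomClassIndexLawFiveLe/Lines/eisenstein_resource_bdp_line.lean`.
-/

set_option autoImplicit false
-- summit-side namespace `Summit.BirchSwinnertonDyer.BirchSwinnertonDyer.…` (single-conjunct summit, D-0017 layout)
set_option linter.dupNamespace false

noncomputable section

open scoped Classical NumberTheorySymbols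
open NumberField WeierstrassCurve DirichletCharacter Literature.NumberTheory.LFunctions
  Literature.NumberTheory.EllipticCurves Literature.NumberTheory.EllipticCurves.KrizLi2019
  Literature.NumberTheory.EllipticCurves.Rank1Residual Literature.NumberTheory.Congruences

namespace Summit.BirchSwinnertonDyer.BirchSwinnertonDyer.Theorems.PrintCFram.HeegnerFieldSupply

open Summit.BirchSwinnertonDyer.BirchSwinnertonDyer.Theorems.PrintCFram
open Summit.BirchSwinnertonDyer.BirchSwinnertonDyer.Theorems.PrintCFram.KummerDictionary
open Summit.BirchSwinnertonDyer.Rank1Residual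
open Literature.NumberTheory.Automorphic.Brandt (norm_lt_one_iff_le_inv)

variable {p : ℕ} [hp : Fact p.Prime]

/-! ## §1 Bookkeeping: the two exponents give the same character (`ω^{p−1} = 1`, `KrizLiBinders.char_pow_sub_one`), `(p−1) ∤ (p−1)/2 + k` -/

/-- **`ω^{(p−1)/2 + k − 1} = ω^{p − k − 1}` as characters** for `p ≡ 3 (mod 4)` and `k ∈ {(p+1)/4, (3p−1)/4}` (the exponents agree
modulo `p − 1`, `…Seed.half_add_classExponent_pred`). [cite: Washington1997, §5.1] -/
theorem teichmuller_pow_half_add_eq (hp3 : p % 4 = 3) {k : ℕ} (hk : k = (p + 1) / 4 ∨ k = (3 * p - 1) / 4)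
    (ω : DirichletCharacter ℚ_[p] p) : ω ^ ((p - 1) / 2 + k - 1) = ω ^ (p - k - 1) := by
  have hk1 : 1 ≤ k := by omega
  have e : (p - 1) / 2 + k - 1 = (p - 1) / 2 + (k - 1) := by omega
  rw [e]
  rcases half_add_classExponent_pred hp3 hk with h | h
  · rw [h, show p - 1 - k = p - k - 1 by omega]
  · rw [h, pow_add, KrizLiBinders.char_pow_sub_one, mul_one, show p - 1 - k = p - k - 1 by omega]

omit hp in
/-- **`(p−1) ∤ (p−1)/2 + k`** for `p ≡ 3 (mod 4)`, `p ≥ 7`, `k ∈ {(p+1)/4, (3p−1)/4}` (`(p−1)/2 + k ∈ {(3p−1)/4, (5p−3)/4}` lies strictly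
between consecutive multiples of `p − 1`) — the branch `χω^{(p−1)/2 + k}` is not `χ`. [folklore] -/
theorem not_dvd_half_add_classExponent (hp3 : p % 4 = 3) (h7 : 7 ≤ p) {k : ℕ}
    (hk : k = (p + 1) / 4 ∨ k = (3 * p - 1) / 4) : ¬ (p - 1 ∣ (p - 1) / 2 + k) := by
  rintro ⟨q, hq⟩
  have hq0 : q ≠ 0 := by rintro rfl; omega
  have hq1 : q ≠ 1 := by rintro rfl; omega
  have h2 : (p - 1) * 2 ≤ (p - 1) * q := Nat.mul_le_mul_left _ (by omega)
  omega

/-! ## §2 The reflection congruence -/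

section Reflection

variable {m : ℕ} [hm : NeZero m]

/-- **THE CM REFLECTION: `‖(1/k) B_{k, χ↑(ω^{(p−1)/2})↑} − (1/(p−k)) B_{p−k, χ}‖_p < 1`** for `p ≡ 3 (mod 4)`, `p ≥ 7`, `m ⊥ p`, ANY
`ℚ_p`-valued Dirichlet character `χ` modulo `m`, `ω` Teichmüller and `k ∈ {(p+1)/4, (3p−1)/4}`. Here `χ↑(ω^{(p−1)/2})↑` is the
level-`m·p` character `χ·(·/p)` (the twist of `χ` by the Kronecker character of `ℚ(√−p)`, `…Seed.teichmuller_pow_half_eq_legendreSym`).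
Both terms are congruent to `B_{1, χ↑(ω^{p−k−1})↑}`: the second by the tame Kummer congruence at index `p − k`, the first by its
ramified-branch twin at `a = (p−1)/2` and index `k`, the two index-`1` characters being EQUAL (§1). In Cohen–Eisenstein terms:
`H(k, pN) ≡ H(p−k, N) (mod p)`. [cite: Washington1997, Thm. 5.11 and Cor. 5.13] [cite: LangCyclotomic1990, Ch. 2 §2, Thm. 2.5] -/
theorem norm_div_generalizedBernoulli_legendreTwist_sub_div_lt_one (hp3 : p % 4 = 3) (h7 : 7 ≤ p) (hmp : m.Coprime p)
    (χ : DirichletCharacter ℚ_[p] m) {ω : DirichletCharacter ℚ_[p] p} (hω : IsTeichmullerCharacter ω)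
    {k : ℕ} (hk : k = (p + 1) / 4 ∨ k = (3 * p - 1) / 4) :
    ‖(k : ℚ_[p])⁻¹ * generalizedBernoulli k (changeLevel (dvd_mul_right m p) χ *
          changeLevel (dvd_mul_left p m) (ω ^ ((p - 1) / 2))) -
        ((p - k : ℕ) : ℚ_[p])⁻¹ * generalizedBernoulli (p - k) χ‖ < 1 := by
  have hk2 : 2 ≤ k := by omega
  have hkp : k ≤ p - 2 := by omega
  -- left: ramified branch, `a = (p−1)/2`
  have hA := CharacterTwist.norm_generalizedBernoulli_one_sub_div_lt_one_ramified hmp χ ω hω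
    (a := (p - 1) / 2) (k := k) (by omega) (by omega) (not_dvd_half_add_classExponent hp3 h7 hk)
  rw [teichmuller_pow_half_add_eq hp3 hk ω] at hA
  -- right: tame congruence at index `p − k`
  have hB := CharacterTwist.norm_generalizedBernoulli_one_sub_div_lt_one hmp χ ω hω (k := p - k) (by omega) (by omega)
  set X := generalizedBernoulli 1 (changeLevel (dvd_mul_right m p) χ * changeLevel (dvd_mul_left p m) (ω ^ (p - k - 1)))
  set A := (k : ℚ_[p])⁻¹ * generalizedBernoulli k (changeLevel (dvd_mul_right m p) χ *
    changeLevel (dvd_mul_left p m) (ω ^ ((p - 1) / 2)))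
  set B := ((p - k : ℕ) : ℚ_[p])⁻¹ * generalizedBernoulli (p - k) χ
  have e : A - B = (X - B) + -(X - A) := by ring
  rw [e]
  refine (IsUltrametricDist.norm_add_le_max _ _).trans_lt (max_lt hB ?_)
  rwa [norm_neg]

/-- **`(1/k) B_{k, χ↑(ω^{(p−1)/2})↑}` is `p`-integral** (same binders). [cite: Washington1997, Thm. 5.11 and Cor. 5.13] -/
theorem norm_div_generalizedBernoulli_legendreTwist_le_one (hp3 : p % 4 = 3) (h7 : 7 ≤ p) (hmp : m.Coprime p)
    (χ : DirichletCharacter ℚ_[p] m) {ω : DirichletCharacter ℚ_[p] p} (hω : IsTeichmullerCharacter ω)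
    {k : ℕ} (hk : k = (p + 1) / 4 ∨ k = (3 * p - 1) / 4) :
    ‖(k : ℚ_[p])⁻¹ * generalizedBernoulli k (changeLevel (dvd_mul_right m p) χ *
        changeLevel (dvd_mul_left p m) (ω ^ ((p - 1) / 2)))‖ ≤ 1 :=
  CharacterTwist.norm_generalizedBernoulli_div_le_one_ramified hmp χ ω hω (a := (p - 1) / 2) (k := k)
    (by omega) (by omega) (not_dvd_half_add_classExponent hp3 h7 hk)

/-- **The reflection in the stubs' currency: `‖(1/k) B_{k, χ·(·/p)}‖ ≤ p⁻¹ ⟺ ‖(1/(p−k)) B_{p−k, χ}‖ ≤ p⁻¹`** — «the field factor of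
`(P)` at `d = −p` is a non-unit iff the class factor is». [cite: Washington1997, Thm. 5.11 and Cor. 5.13] [cite: KrizLi2019, Thm. 1.20 (p. 8) and §8] -/
theorem norm_div_generalizedBernoulli_legendreTwist_le_inv_iff (hp3 : p % 4 = 3) (h7 : 7 ≤ p) (hmp : m.Coprime p)
    (χ : DirichletCharacter ℚ_[p] m) {ω : DirichletCharacter ℚ_[p] p} (hω : IsTeichmullerCharacter ω)
    {k : ℕ} (hk : k = (p + 1) / 4 ∨ k = (3 * p - 1) / 4) :
    ‖(k : ℚ_[p])⁻¹ * generalizedBernoulli k (changeLevel (dvd_mul_right m p) χ *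
        changeLevel (dvd_mul_left p m) (ω ^ ((p - 1) / 2)))‖ ≤ (p : ℝ)⁻¹ ↔
      ‖((p - k : ℕ) : ℚ_[p])⁻¹ * generalizedBernoulli (p - k) χ‖ ≤ (p : ℝ)⁻¹ := by
  have h1 := norm_div_generalizedBernoulli_legendreTwist_sub_div_lt_one hp3 h7 hmp χ hω hk
  set A := (k : ℚ_[p])⁻¹ * generalizedBernoulli k (changeLevel (dvd_mul_right m p) χ *
    changeLevel (dvd_mul_left p m) (ω ^ ((p - 1) / 2)))
  set B := ((p - k : ℕ) : ℚ_[p])⁻¹ * generalizedBernoulli (p - k) χ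
  rw [← norm_lt_one_iff_le_inv, ← norm_lt_one_iff_le_inv]
  have hsub : ∀ x y : ℚ_[p], ‖x - y‖ ≤ max ‖x‖ ‖y‖ := fun x y ↦ by
    simpa only [sub_eq_add_neg, norm_neg] using IsUltrametricDist.norm_add_le_max x (-y)
  constructor
  · intro hA
    have e : B = A - (A - B) := by ring
    rw [e]
    exact (hsub _ _).trans_lt (max_lt hA h1)
  · intro hB
    have e : A = (A - B) + B := by ring
    rw [e]
    exact (IsUltrametricDist.norm_add_le_max _ _).trans_lt (max_lt h1 hB)

end Reflection

/-! ## §3 On the crux's binders -/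

section Binders

variable (W : WeierstrassCurve ℚ) [W.IsElliptic]

/-- **B1's premise ⟺ `p ∣ (1/k) B_{k, χ·(·/p)}`; Stub C's class hypothesis ⟺ `p ∤ (1/k) B_{k, χ·(·/p)}`** — for every odd datum `(f, ψ, ω)`
with `hss` and class data `(m, χ, ε, k)` as in `KummerDictionary.norm_bernoulliOnePrim_inv_le_inv_iff_of_hss`:
`‖bernoulliOnePrim ψ⁻¹‖ ≤ p⁻¹ ↔ ‖(1/k) B_{k, χ↑(ω^{(p−1)/2})↑}‖ ≤ p⁻¹`. The class factor of the crux is the `p·|e|`-th coefficient of the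
series `N ↦ H(k, N)` whose `|e·d|`-th coefficients are the field factors of `(P)`. [cite: KrizLi2019, Thm. 1.20 (p. 8) and §8 (pp. 49–52)] [cite: Washington1997, Thm. 5.11 and Cor. 5.13] -/
theorem norm_bernoulliOnePrim_inv_le_inv_iff_legendreTwist (hCM : W.HasCM) (hram : CMRamified W p) (h5 : 5 ≤ p)
    {m : ℕ} [NeZero m] (χ : DirichletCharacter ℚ_[p] m) (ε : ℕ → ℤ) (k : ℕ) (ω : DirichletCharacter ℚ_[p] p)
    (hχ : χ.IsPrimitive) (hχq : χ.IsQuadratic) (hmp : m.Coprime p)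
    (hε : ∀ ℓ : ℕ, ℓ.Prime → ℓ ≠ p → χ (ℓ : ZMod m) = (ε ℓ : ℚ_[p]))
    (hk : k = (p + 1) / 4 ∨ k = (3 * p - 1) / 4) (hk2 : 2 ≤ k) (hkp : k ≤ p - 2) (hpar : χ (-1) * (-1) ^ k = -1)
    (htr : ∀ ℓ : ℕ, ℓ.Prime → ℓ ≠ p →
      ((W.LFunction ℓ : ℤ) : ZMod p) = (ε ℓ : ZMod p) * ((ℓ : ZMod p) ^ k + (ℓ : ZMod p) ^ (p - k)))
    (hgoodW : ∀ ℓ : ℕ, (hℓ : ℓ.Prime) → ℓ ≠ p → ¬ ℓ ∣ m → (haveI := Fact.mk hℓ; W.HasGoodReductionAtPrime ℓ))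
    (hω : IsTeichmullerCharacter ω) {f : ℕ} [NeZero f] (ψ : DirichletCharacter ℚ_[p] f) (hψ : ψ.Odd)
    (hss : ∀ ℓ : ℕ, ℓ.Prime → ¬ (ℓ ∣ p * W.conductorNorm ℤ) →
      ‖((W.LFunction ℓ : ℤ) : ℚ_[p]) - (ψ (ℓ : ZMod f) + ψ⁻¹ (ℓ : ZMod f) * ω (ℓ : ZMod p))‖ < 1) :
    ‖bernoulliOnePrim ψ⁻¹‖ ≤ (p : ℝ)⁻¹ ↔
      ‖(k : ℚ_[p])⁻¹ * generalizedBernoulli k (changeLevel (dvd_mul_right m p) χ *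
        changeLevel (dvd_mul_left p m) (ω ^ ((p - 1) / 2)))‖ ≤ (p : ℝ)⁻¹ := by
  have hp3 := mod_four_eq_three_of_cmRamified W hCM hram h5
  have h7 : 7 ≤ p := by
    rcases (X12.eq_of_dvd_cmFieldDiscrOfJ W hCM hp.out h5 hram).1 with h | h | h | h | h | h <;> omega
  rw [norm_bernoulliOnePrim_inv_le_inv_iff_of_hss W χ ε k ω ψ h5 hχ hχq hmp hε hk2 hkp hpar htr hgoodW hω hψ hss,
    norm_div_generalizedBernoulli_legendreTwist_le_inv_iff hp3 h7 hmp χ hω hk]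

end Binders

/-! ## §4 The character `χ↑(ω^{(p−1)/2})↑` is `(χ·ε_{K₀})~`: primitive of conductor `m·p`, values `χ(ℓ)ε_{K₀}(ℓ)` -/

section Values

variable {m : ℕ} [hm : NeZero m]

/-- **`χ↑(ω^{(p−1)/2})↑` is PRIMITIVE (conductor `m·p`)** for `χ` primitive mod `m ⊥ p`, `ω` Teichmüller, `p ≥ 5`
(w8 g3's `thetaShape_isPrimitive` at `j = (p−1)/2`). [cite: Washington1997, Ch. 3 (conductors) and §5.1] -/
theorem legendreTwist_isPrimitive (h5 : 5 ≤ p) (hmp : m.Coprime p) (χ : DirichletCharacter ℚ_[p] m) (hχ : χ.IsPrimitive)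
    {ω : DirichletCharacter ℚ_[p] p} (hω : IsTeichmullerCharacter ω) :
    (changeLevel (dvd_mul_right m p) χ * changeLevel (dvd_mul_left p m) (ω ^ ((p - 1) / 2)) :
      DirichletCharacter ℚ_[p] (m * p)).IsPrimitive :=
  thetaShape_isPrimitive hmp χ hχ hω (by omega) (by omega)

omit hm in
/-- **Values: `(χ↑(ω^{(p−1)/2})↑)(ℓ) = χ(ℓ)·ε_{K₀}(ℓ)` at every prime `ℓ ≠ p`**, for `K₀` imaginary quadratic with `d_{K₀} = −p`
(`p ≡ 3 (mod 4)`) and `ε_{K₀}` a Kronecker character of `K₀` — so `χ↑(ω^{(p−1)/2})↑` is the primitive character inducing `χ·ε_{K₀}`,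
the character of `(P)`'s field factor at `K = K₀` (w3 g7's `BernoulliUnits.changeLevel_eq_of_forall_prime_apply_eq` reading).
[cite: Cox2013, §1.C Lemma 1.14] [cite: KrizLi2019, §2 (p. 12, ε_K)] -/
theorem legendreTwist_apply_prime (hp3 : p % 4 = 3) (χ : DirichletCharacter ℚ_[p] m)
    {ω : DirichletCharacter ℚ_[p] p} (hω : IsTeichmullerCharacter ω)
    {K₀ : Type} [Field K₀] [NumberField K₀] (hK₀ : IsImaginaryQuadratic K₀) (hd : NumberField.discr K₀ = -(p : ℤ))
    {ε₀ : DirichletCharacter ℚ_[p] (NumberField.discr K₀).natAbs} (hε₀ : IsKroneckerCharacterOf K₀ ε₀)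
    {ℓ : ℕ} (hℓ : ℓ.Prime) (hℓp : ℓ ≠ p) :
    (changeLevel (dvd_mul_right m p) χ * changeLevel (dvd_mul_left p m) (ω ^ ((p - 1) / 2)) :
      DirichletCharacter ℚ_[p] (m * p)) (ℓ : ZMod (m * p)) =
      χ (ℓ : ZMod m) * ε₀ (ℓ : ZMod (NumberField.discr K₀).natAbs) := by
  have hh : (p - 1) / 2 ≠ 0 := by
    have := hp.out.two_le
    omega
  rw [thetaShape_apply_natCast χ ω hh, kroneckerCharacter_apply_eq_teichmuller_pow hp3 hK₀ hd hε₀ hω hℓ hℓp]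

end Values

end Summit.BirchSwinnertonDyer.BirchSwinnertonDyer.Theorems.PrintCFram.HeegnerFieldSupply

end
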